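import Summits.BirchSwinnertonDyer.Rank1Residual.X11b.SelmerTorsionControl
import Literature.NumberTheory.GaloisRepresentations.ContinuousCohomologyCoefficientColimit
import Mathlib.Algebra.Module.CharacterModule
import HarnessLib

/-!
# Crux 4 `BSDpOnCellC` (stmt-BirchSwinnertonDyer-19034), line «telescope», leaf N2 sub-leaf W3 / leaf N3′ — TRANSPORT OF `H¹`,
# SELMER GROUPS AND THEIR PONTRYAGIN DUALS ALONG A MORPHISM OF COEFFICIENTS WITH BOUNDED-TORSION KERNEL AND COKERNEL
# (successor LEAD `cruxlead-19034` g3; `--supports`, helper; generic cocycle algebra, THEOREMS ONLY)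

HONEST FRAMING. Nothing in this file is specific to elliptic curves; it proves no stub, no crux and no summit statement; BSD is proved
for no curve. It is the generic half of the «transport along a quasi-isomorphism of coefficients» step (m3) of ideator bsd-idea-12 g36's
pricing memo `Cruxes/BSDpOnCellC/W-PRICING-n2.md` (sub-leaf W3 `stub_weightTwoTransport` of leaf N2 `stub_weightTwoControl`, and the
transport along `θ_k` inside leaf N3′ `stub_memberControlMod` of telescope v9): there the fibre data (fd₀)/(fd_k) of leaf N1 give an
equivariant map of discrete coefficient modules `θ : A₂[π] → A'` with FINITE kernel and cokernel, hence the induced map of big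
(co-induced) modules `Θ : M₂[π] → M'` has kernel and cokernel killed by a power of `p`; this file turns such a `Θ` into statements about
`H¹`, Selmer groups and their Pontryagin duals with explicit annihilators.

SETTING. `Γ` a topological group, `A` a commutative coefficient ring, `ρ₁ : ContinuousRep Γ A M₁`, `ρ₂ : ContinuousRep Γ A M₂` on
DISCRETE modules, `f : ρ₁.toTopRep ⟶ ρ₂.toTopRep` a morphism (equivariant, `A`-linear), and scalars `a b : A` with
(hker) `∀ m, f m = 0 → a • m = 0` (the kernel of `f` is killed by `a`) and (hcoker) `∀ m₂, ∃ m₁, f m₁ = b • m₂` (the cokernel of `f` is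
killed by `b`). Local conditions: any family `φ v : Γ_v →ₜ* Γ` and constrained set `L` (the tree's `TorsionControl.selmer φ L ρ`).

* §1 `smul_eq_zero_of_cohomologyMap_eq_zero` — **`ker H¹(f)` is killed by `a * b`**: `H¹(f) x = 0 → (a * b) • x = 0`.
  `exists_cohomologyMap_eq_smul` — **`coker H¹(f)` is killed by `a * b`**: `∀ y, ∃ x, H¹(f) x = (a * b) • y` (the lift `s ∘ ψ` of a
  cocycle `ψ` along a set-theoretic section `s` of `f` over `b • M₂` has coboundary valued in `ker f`, so `a • (s ∘ ψ)` is a cocycle).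
* §2 `smul_eq_zero_of_cohomologyMap_eq_zero_of_mem_selmer` / **`exists_mem_selmer_cohomologyMap_eq_smul`** — the same for the Selmer
  groups `Sel_L(ρ₁) → Sel_L(ρ₂)`: kernel killed by `a * b`, cokernel killed by `(a * b) ^ 2` (one factor to lift the class, one factor to
  kill the constrained local restrictions of the lift, by §1 applied to the restricted representations `ρᵢ.restrict (φ v)`).
* §3 the PONTRYAGIN-DUAL form used by the weight-two / member transport: **`exists_dual_selmer_transfer`** — an `A`-linear
  `β = (Sel f)^∨ : Sel_L(ρ₂)^∨ → Sel_L(ρ₁)^∨` (stated by its defining identity, no new definition) with **kernel killed by `(a * b) ^ 2`**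
  and **cokernel killed by `a * b`** (a character of `Sel_L(ρ₁)` multiplied by `a * b` vanishes on `ker (Sel f)`, so it factors through
  the image and extends to `Sel_L(ρ₂)` by divisibility of `ℚ/ℤ`, Mathlib `CharacterModule.dual_surjective_of_injective`). THEOREMS ONLY.

Downstream (not here): with `A = Λ = ℤ_p⟦T⟧`, `a = b = p^e`, the char-ideal calculus (`Module.charIdeal_eq_mul_of_exact`,
`exists_span_pow_le_charIdeal_of_isTorsionBy`) turns §3 into `(p^{e'}) · char_Λ(Sel_L(ρ₁)^∨) ⊆ char_Λ(Sel_L(ρ₂)^∨)` for finitely generated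
torsion duals — the shape of W3's `p^e · char_Λ(Y) ⊆ …` clause.

References: J.-P. Serre, *Galois Cohomology* (1997), I §2.2–2.4 (cocycles, functoriality) [SerreGaloisCohomology1997]; R. Greenberg,
*Iwasawa theory for elliptic curves*, LNM 1716 (1999), §4 (control arguments with bounded kernels and cokernels) [GreenbergLNM1716];
C. Skinner–E. Urban, Invent. Math. 195 (2014), Lemma 3.2.6 / Prop. 3.2.3 (shape only) [SkinnerUrban2014].
-/

noncomputable section

open CategoryTheory Literature.NumberTheory.GaloisRepresentations
open scoped ContRepresentation

universe u

set_option linter.dupNamespace false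

namespace Summit.BirchSwinnertonDyer.BirchSwinnertonDyer.Theorems.TelescopeK2CohomologyTransfer

open Summit.BirchSwinnertonDyer.Rank1Residual.X11b.TorsionControl

variable {A : Type*} [CommRing A] [TopologicalSpace A]
variable {Γ : Type u} [Group Γ] [TopologicalSpace Γ] [IsTopologicalGroup Γ]
variable {M₁ : Type u} [AddCommGroup M₁] [Module A M₁] [TopologicalSpace M₁] [DiscreteTopology M₁]
  [ContinuousSMul A M₁]
variable {M₂ : Type u} [AddCommGroup M₂] [Module A M₂] [TopologicalSpace M₂] [DiscreteTopology M₂]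
  [ContinuousSMul A M₂]
variable {ρ₁ : ContinuousRep Γ A M₁} {ρ₂ : ContinuousRep Γ A M₂}

/-! ## §1 `H¹`: kernel and cokernel of `H¹(f)` are killed by `a * b` -/

/-- **`ker H¹(f)` is killed by `a * b`.** If `f : M₁ → M₂` has kernel killed by `a` and cokernel killed by `b`, and the class `x ∈ H¹(Γ, M₁)`
dies under `H¹(f)`, then `(a * b) • x = 0`: writing `f ∘ φ = ∂v` and `f m₁ = b • v`, the cochain `b • φ − ∂m₁` is valued in `ker f`, so
`a • (b • φ − ∂m₁) = 0`, i.e. `(a * b) • φ = ∂(a • m₁)`. [cite: SerreGaloisCohomology1997, I §2.2 and §5.1] -/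
theorem smul_eq_zero_of_cohomologyMap_eq_zero (f : ρ₁.toTopRep ⟶ ρ₂.toTopRep) {a b : A}
    (hker : ∀ m : M₁, f.hom m = 0 → a • m = 0) (hcoker : ∀ m₂ : M₂, ∃ m₁ : M₁, f.hom m₁ = b • m₂)
    {x : continuousCohomology 1 ρ₁.toTopRep} (hx : cohomologyMap f 1 x = 0) :
    (a * b) • x = 0 := by
  obtain ⟨φ, rfl⟩ := oneCocycleClass_surjective _ x
  obtain ⟨v, hv⟩ := (ContinuousRep.cohomologyMap_oneCocycleClass_eq_zero_iff f φ).1 hx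
  obtain ⟨m₁, hm₁⟩ := hcoker v
  rw [← oneCocycleClass_smul, oneCocycleClass_eq_zero_iff]
  refine ⟨a • m₁, fun g => ?_⟩
  have h1 : f.hom (b • φ.1 g - (ρ₁ g m₁ - m₁)) = 0 := by
    rw [map_sub, map_sub, map_smul, hv g, ContinuousRep.hom_comm_apply f g m₁, hm₁, map_smul,
      smul_sub, sub_self]
  have h2 := hker _ h1
  rw [smul_sub, sub_eq_zero, ← mul_smul] at h2
  change (a * b) • φ.1 g = ρ₁.toTopRep.ρ g (a • m₁) - a • m₁
  rw [h2, smul_sub, ContinuousRep.toTopRep_ρ_apply, map_smul]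

omit [IsTopologicalGroup Γ] in
/-- A set-theoretic section of `f` over `b • M₂`: `f (sect m₂) = b • m₂`. [folklore] -/
theorem exists_section (f : ρ₁.toTopRep ⟶ ρ₂.toTopRep) {b : A}
    (hcoker : ∀ m₂ : M₂, ∃ m₁ : M₁, f.hom m₁ = b • m₂) :
    ∃ s : M₂ → M₁, ∀ m₂, f.hom (s m₂) = b • m₂ :=
  ⟨fun m₂ => (hcoker m₂).choose, fun m₂ => (hcoker m₂).choose_spec⟩

omit [IsTopologicalGroup Γ] in
/-- **The lifted cocycle.** For a continuous crossed homomorphism `ψ : Γ → M₂` and a section `s` of `f` over `b • M₂`, the continuous map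
`a • (s ∘ ψ) : Γ → M₁` (continuity: `M₂` is discrete) is a crossed homomorphism: its defect `η(gh) − η(g) − g•η(h)` (for `η = s ∘ ψ`) maps to
`b • 0 = 0` under `f`, hence is killed by `a`. [cite: SerreGaloisCohomology1997, I §2.2] -/
theorem smul_comp_mem_contOneCocycles (f : ρ₁.toTopRep ⟶ ρ₂.toTopRep) {a b : A}
    (hker : ∀ m : M₁, f.hom m = 0 → a • m = 0) {s : M₂ → M₁} (hs : ∀ m₂, f.hom (s m₂) = b • m₂)
    (ψ : contOneCocycles ρ₂.toTopRep) :
    a • (⟨s, continuous_of_discreteTopology⟩ : C(M₂, M₁)).comp ψ.1 ∈ contOneCocycles ρ₁.toTopRep := by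
  rw [mem_contOneCocycles_iff]
  intro g h
  have hdef : f.hom (s (ψ.1 (g * h)) - s (ψ.1 g) - ρ₁ g (s (ψ.1 h))) = 0 := by
    rw [map_sub, map_sub, hs, hs, ContinuousRep.hom_comm_apply f g, hs, map_smul, ψ.2 g h,
      ContinuousRep.toTopRep_ρ_apply, smul_add, add_sub_cancel_left, sub_self]
  have h2 := hker _ hdef
  rw [smul_sub, smul_sub, sub_sub, sub_eq_zero] at h2
  change a • s (ψ.1 (g * h)) = a • s (ψ.1 g) + ρ₁.toTopRep.ρ g (a • s (ψ.1 h))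
  rw [h2, ContinuousRep.toTopRep_ρ_apply, map_smul]

/-- **`coker H¹(f)` is killed by `a * b`.** Every class `y ∈ H¹(Γ, M₂)` has `(a * b) • y = H¹(f) x` for some `x ∈ H¹(Γ, M₁)` (the class
of the lifted cocycle `a • (s ∘ ψ)`). [cite: SerreGaloisCohomology1997, I §2.2] -/
theorem exists_cohomologyMap_eq_smul (f : ρ₁.toTopRep ⟶ ρ₂.toTopRep) {a b : A}
    (hker : ∀ m : M₁, f.hom m = 0 → a • m = 0) (hcoker : ∀ m₂ : M₂, ∃ m₁ : M₁, f.hom m₁ = b • m₂)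
    (y : continuousCohomology 1 ρ₂.toTopRep) :
    ∃ x : continuousCohomology 1 ρ₁.toTopRep, cohomologyMap f 1 x = (a * b) • y := by
  obtain ⟨ψ, rfl⟩ := oneCocycleClass_surjective _ y
  obtain ⟨s, hs⟩ := exists_section f hcoker
  refine ⟨oneCocycleClass _ ⟨_, smul_comp_mem_contOneCocycles f hker hs ψ⟩, ?_⟩
  rw [cohomologyMap_oneCocycleClass, ← oneCocycleClass_smul]
  refine congrArg _ (Subtype.ext (ContinuousMap.ext fun g => ?_))
  rw [pullback_id_resIdHom_apply]
  change f.hom (a • s (ψ.1 g)) = (a * b) • ψ.1 g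
  rw [map_smul, hs, ← mul_smul]

/-! ## §2 Selmer groups: kernel killed by `a * b`, cokernel by `(a * b) ^ 2` -/

variable {ι : Type*} {Γv : ι → Type u} [∀ v, Group (Γv v)] [∀ v, TopologicalSpace (Γv v)]
  [∀ v, IsTopologicalGroup (Γv v)] (φ : ∀ v, Γv v →ₜ* Γ) (L : Set ι)

/-- **The kernel of `Sel_L(ρ₁) → Sel_L(ρ₂)` is killed by `a * b`** (a restatement of §1 for Selmer classes; the local conditions play no
role). [cite: GreenbergLNM1716, §4] -/
theorem smul_eq_zero_of_cohomologyMap_eq_zero_of_mem_selmer (f : ρ₁.toTopRep ⟶ ρ₂.toTopRep) {a b : A}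
    (hker : ∀ m : M₁, f.hom m = 0 → a • m = 0) (hcoker : ∀ m₂ : M₂, ∃ m₁ : M₁, f.hom m₁ = b • m₂)
    {x : continuousCohomology 1 ρ₁.toTopRep} (_hx : x ∈ selmer φ L ρ₁) (h0 : cohomologyMap f 1 x = 0) :
    (a * b) • x = 0 :=
  smul_eq_zero_of_cohomologyMap_eq_zero f hker hcoker h0

omit [IsTopologicalGroup Γ] in
/-- The restricted morphism `f|_{Γ_v}` has the same kernel bound (same underlying map). [folklore] -/
theorem restrictHom_hker {H : Type u} [Group H] [TopologicalSpace H] (θ : H →ₜ* Γ)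
    (f : ρ₁.toTopRep ⟶ ρ₂.toTopRep) {a : A} (hker : ∀ m : M₁, f.hom m = 0 → a • m = 0) :
    ∀ m : M₁, (restrictHom θ f).hom m = 0 → a • m = 0 :=
  fun m hm => hker m (by rwa [restrictHom_hom_apply] at hm)

omit [IsTopologicalGroup Γ] in
/-- The restricted morphism `f|_{Γ_v}` has the same cokernel bound (same underlying map). [folklore] -/
theorem restrictHom_hcoker {H : Type u} [Group H] [TopologicalSpace H] (θ : H →ₜ* Γ)
    (f : ρ₁.toTopRep ⟶ ρ₂.toTopRep) {b : A} (hcoker : ∀ m₂ : M₂, ∃ m₁ : M₁, f.hom m₁ = b • m₂) :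
    ∀ m₂ : M₂, ∃ m₁ : M₁, (restrictHom θ f).hom m₁ = b • m₂ :=
  fun m₂ => by
    obtain ⟨m₁, hm₁⟩ := hcoker m₂
    exact ⟨m₁, by rw [restrictHom_hom_apply, hm₁]⟩

/-- **The cokernel of `Sel_L(ρ₁) → Sel_L(ρ₂)` is killed by `(a * b) ^ 2`.** For `y ∈ Sel_L(ρ₂)`: §1 gives `x₀` with `H¹(f) x₀ = (ab) • y`;
at each constrained `v ∈ L`, `res_v (H¹(f) x₀) = (ab) • res_v y = 0`, so by §1 for the restricted representations `(ab) • res_v x₀ = 0`; hence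
`x := (ab) • x₀ ∈ Sel_L(ρ₁)` and `H¹(f) x = (ab)² • y`. [cite: GreenbergLNM1716, §4] [cite: SkinnerUrban2014, Lemma 3.2.6 (shape only)] -/
theorem exists_mem_selmer_cohomologyMap_eq_smul (f : ρ₁.toTopRep ⟶ ρ₂.toTopRep) {a b : A}
    (hker : ∀ m : M₁, f.hom m = 0 → a • m = 0) (hcoker : ∀ m₂ : M₂, ∃ m₁ : M₁, f.hom m₁ = b • m₂)
    {y : continuousCohomology 1 ρ₂.toTopRep} (hy : y ∈ selmer φ L ρ₂) :
    ∃ x ∈ selmer φ L ρ₁, cohomologyMap f 1 x = ((a * b) ^ 2) • y := by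
  obtain ⟨x₀, hx₀⟩ := exists_cohomologyMap_eq_smul f hker hcoker y
  refine ⟨(a * b) • x₀, ?_, ?_⟩
  · rw [mem_selmer_iff] at hy ⊢
    intro v hv
    have h1 : cohomologyMap (restrictHom (φ v) f) 1 (resH1 ρ₁ (φ v) x₀) = 0 := by
      rw [← resH1_cohomologyMap, hx₀, map_smul, hy v hv, smul_zero]
    rw [map_smul]
    exact smul_eq_zero_of_cohomologyMap_eq_zero (restrictHom (φ v) f) (restrictHom_hker (φ v) f hker)
      (restrictHom_hcoker (φ v) f hcoker) h1
  · rw [map_smul, hx₀, ← mul_smul, pow_two]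

/-! ## §3 Pontryagin duals: a dual transfer map `β = (Sel f)^∨` with kernel killed by `(a * b) ^ 2` and cokernel killed by `a * b` -/

/-- **The Pontryagin-dual transfer.** There is an `A`-linear `β : Sel_L(ρ₂)^∨ → Sel_L(ρ₁)^∨` — precomposition with
`Sel f = H¹(f)|_{Sel}` (no new definition is introduced: `β` is `CharacterModule.dual` of the restriction–corestriction of `H¹(f)`,
and its defining identity is part of the statement) — such that (i) `β χ (x) = χ (H¹(f) x)`; (ii) **`ker β` is killed by `(a * b) ^ 2`**
(a character of `Sel_L(ρ₂)` vanishing on the image of `Sel f` vanishes on `(ab)² • Sel_L(ρ₂)`, §2); (iii) **`coker β` is killed by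
`a * b`**: for every character `χ` of `Sel_L(ρ₁)`, `(ab) • χ` is constant on the fibres of `Sel f` (it kills `ker (Sel f)`, §2), so it
descends to `im (Sel f)` and extends to a character of `Sel_L(ρ₂)` because `ℚ/ℤ` is divisible (Mathlib
`CharacterModule.dual_surjective_of_injective`). With `A = Λ` and finitely generated torsion duals this is the input of the tree's
`exists_span_pow_mul_charIdeal_le_of_ker` / `…_of_coker` (char ideals compared up to a power of `ab`).
[cite: GreenbergLNM1716, §4] [cite: SkinnerUrban2014, Lemma 3.2.6 (shape only)] -/
theorem exists_dual_selmer_transfer (f : ρ₁.toTopRep ⟶ ρ₂.toTopRep) {a b : A}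
    (hker : ∀ m : M₁, f.hom m = 0 → a • m = 0) (hcoker : ∀ m₂ : M₂, ∃ m₁ : M₁, f.hom m₁ = b • m₂) :
    ∃ β : CharacterModule (selmer φ L ρ₂) →ₗ[A] CharacterModule (selmer φ L ρ₁),
      (∀ (χ : CharacterModule (selmer φ L ρ₂)) (x : selmer φ L ρ₁),
          β χ x = χ ⟨cohomologyMap f 1 x, cohomologyMap_mem_selmer φ L f x.2⟩) ∧
      (∀ χ : CharacterModule (selmer φ L ρ₂), β χ = 0 → ((a * b) ^ 2) • χ = 0) ∧
      (∀ χ : CharacterModule (selmer φ L ρ₁), (a * b) • χ ∈ LinearMap.range β) := by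
  classical
  -- `F = Sel f`, the restriction–corestriction of `H¹(f)`
  let F : selmer φ L ρ₁ →ₗ[A] selmer φ L ρ₂ :=
    ((cohomologyMap f 1).hom.toLinearMap.domRestrict (selmer φ L ρ₁)).codRestrict (selmer φ L ρ₂)
      fun x => cohomologyMap_mem_selmer φ L f x.2
  have hF : ∀ x : selmer φ L ρ₁, (F x : continuousCohomology 1 ρ₂.toTopRep) = cohomologyMap f 1 x :=
    fun x => rfl
  -- ker F killed by `ab`, coker F by `(ab)²` (§1, §2)
  have hFker : ∀ {x : selmer φ L ρ₁}, F x = 0 → (a * b) • x = 0 := fun {x} hx =>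
    Subtype.ext (smul_eq_zero_of_cohomologyMap_eq_zero f hker hcoker
      (by rw [← hF]; exact congrArg Subtype.val hx))
  have hFcoker : ∀ y : selmer φ L ρ₂, ∃ x : selmer φ L ρ₁, F x = ((a * b) ^ 2) • y := fun y => by
    obtain ⟨x, hx, hxy⟩ := exists_mem_selmer_cohomologyMap_eq_smul φ L f hker hcoker y.2
    exact ⟨⟨x, hx⟩, Subtype.ext hxy⟩
  refine ⟨CharacterModule.dual F, fun χ x => rfl, fun χ hχ => ?_, fun χ => ?_⟩
  · -- (ii) kernel
    ext y
    obtain ⟨x, hx⟩ := hFcoker y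
    rw [CharacterModule.smul_apply, ← hx]
    exact DFunLike.congr_fun hχ x
  · -- (iii) cokernel
    set χ' : CharacterModule (selmer φ L ρ₁) := (a * b) • χ with hχ'
    have key : ∀ x x' : selmer φ L ρ₁, F x = F x' → χ' x = χ' x' := by
      intro x x' h
      have hk : F (x - x') = 0 := by rw [map_sub, h, sub_self]
      have h0 : χ' (x - x') = 0 := by
        rw [hχ', CharacterModule.smul_apply, hFker hk, map_zero]
      rwa [map_sub, sub_eq_zero] at h0
    have hpre : ∀ z : LinearMap.range F, ∃ x, F x = z := fun z => LinearMap.mem_range.1 z.2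
    choose pre hpre using hpre
    let χr : CharacterModule (LinearMap.range F) :=
      { toFun := fun z => χ' (pre z)
        map_zero' := by
          have h := key (pre 0) 0 (by rw [hpre, map_zero]; rfl)
          rw [h, map_zero]
        map_add' := fun z z' => by
          have h := key (pre (z + z')) (pre z + pre z') (by rw [map_add, hpre, hpre, hpre]; rfl)
          rw [h, map_add] }
    have hχr : ∀ x : selmer φ L ρ₁, χr ⟨F x, LinearMap.mem_range_self F x⟩ = χ' x := fun x =>
      key _ _ (hpre _)
    obtain ⟨χ₂, hχ₂⟩ := CharacterModule.dual_surjective_of_injective (LinearMap.range F).subtype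
      (Submodule.injective_subtype _) χr
    refine ⟨χ₂, ?_⟩
    ext x
    have h1 : CharacterModule.dual F χ₂ x = χ₂ (F x) := rfl
    have h2 : χ₂ (F x) = CharacterModule.dual (LinearMap.range F).subtype χ₂
        ⟨F x, LinearMap.mem_range_self F x⟩ := rfl
    rw [h1, h2, hχ₂, hχr]

end Summit.BirchSwinnertonDyer.BirchSwinnertonDyer.Theorems.TelescopeK2CohomologyTransfer

end
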